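import Summits.ABC.StewartYu.ArchG3StartRec
import Summits.ABC.StewartYu.SatBasisReducedLower
import Mathlib.LinearAlgebra.Matrix.Block
import HarnessLib

/-!
# Cell abc-stewartyu, rung A1.L (crux r2 `ArchCoreRat`, stmt-ABC-20502), WP-L.A: the θ-SIDE ATOMS of the letter lines (part (A) of
# `stub_recLinesArch`, plan R47) — shape consequences, `|log θₖ|`, the θ-radius `sθR`, the transported coefficients `b̃`

`Summits/ABC/StewartYu/ArchG3LinesAtoms.lean` — cell `abc-stewartyu` (HOME `run/shared/lean/pub/abc-stewartyu/`; seat p5 g9).  Theorems on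
`ArchG3Setup`/`SatData`; no definition, no named fact.  Under the four SHAPE LETTERS exported by the START (`ArchG3Line.StartDataS`:
`U` lower-triangular in the datum's weight-increasing indexing, `0 ≤ U ≤ N`, `|C| ≤ (n−1)!·N`, pivot `j₀` = last index) every θ-charged atom of
`ArchLinesHoldV` is bounded by a closed form in the record/datum letters (the majorants named in `ArchG3RecLinesClosed`):

* `Lb_eq`, `LνR_eq` — the halving schedules in closed form (`Lb s lev j = 2sⱼ/2^lev`, `LνR P lev j = (2Bv j+1)/2^lev`);
* `SatData.diag_pos`, `SatData.shape`, `SatData.C_diag_le`, `SatData.colsum_le` — `0 < Uₖₖ`, `C` lower-triangular, `Uₖₖ·Cₖₖ = N`,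
  `0 < Cₖₖ ≤ N`, `Σᵢ|Uᵢⱼ| ≤ n·N`;
* `SatData.abs_lg_le` — `|log θₖ| ≤ Σ_{j≤k} Aⱼ` when `|log α°ⱼ| ≤ Aⱼ`;
* `sθR_le`, `sθR_last_le` — `sθR k ≤ (n−1)!·Σ_{j>k}(2Bv j+1) + (2Bv k+1) + 2`, `sθR j₀ ≤ (2Bv j₀+1)·C_{j₀j₀}/N + 2`;
* `SatData.b_eq_sum_Ici`, `SatData.b_last_eq`, `SatData.abs_b_le` — `b̃ₖ = Σ_{j≥k} bⱼCⱼₖ`, `b̃_{j₀} = b_{j₀}·C_{j₀j₀}`,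
  `|b̃ₖ| ≤ (n−1)!·N·B·A_{j₀}·Σ_{j>k}1/Aⱼ + N·B·A_{j₀}/Aₖ` when `|bⱼ|·Aⱼ ≤ B·A_{j₀}`.
The sequel `ArchG3LinesAtomsB` bounds `GammaC`, `YC`, `#unkA`, `⌈#unkA·AmaxR⌉`, `log ∏H(θⱼ)` and assembles `LinesSupplyS`.

WHAT THIS IS NOT: no inequality of the record (seat p1, `ArchG3Rec.linesClosed_holds`); no crux moves.

## References
* Yu. V. Nesterenko, LNM 1819 (2003) — §3.4–3.5 (the lattice `𝔑`, (3.25), Lemma 3.11), §4.2 (4.22). [Nesterenko2003]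
* J. W. S. Cassels, *An Introduction to the Geometry of Numbers*, Ch. I §2.2 (triangular bases). [Cassels1997]
-/

noncomputable section

open Finset Matrix
open scoped Nat Matrix

namespace Summit.ABC.StewartYu

namespace ArchG3Setup

variable (S : ArchG3Setup)

/-! ### The halving schedules in closed form -/

/-- `Lb s lev j = 2·sⱼ / 2^lev`. [folklore] -/
theorem Lb_eq (s : Fin S.n → ℕ) (lev : ℕ) (j : Fin S.n) : S.Lb s lev j = 2 * s j / 2 ^ lev := by
  induction lev with
  | zero => simp [Lb]
  | succ lev ih =>
    show S.Lb s lev j / 2 = _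
    rw [ih, Nat.div_div_eq_div_mul, pow_succ]

/-- `LνR P lev j = (2·Bv j + 1) / 2^lev`. [folklore] -/
theorem LνR_eq (P : ArchG3Rec S.n) (lev : ℕ) (j : Fin S.n) : S.LνR P lev j = (2 * P.Bv j + 1) / 2 ^ lev := by
  induction lev with
  | zero => simp [LνR]
  | succ lev ih => rw [S.LνR_succ, ih, Nat.div_div_eq_div_mul, pow_succ]

/-- `Lb s lev j ≤ 2·tⱼ/2^lev` whenever `sⱼ ≤ tⱼ`. [folklore] -/
theorem Lb_le_of_le {s : Fin S.n → ℕ} {t : Fin S.n → ℕ} (h : ∀ j, s j ≤ t j) (lev : ℕ) (j : Fin S.n) :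
    S.Lb s lev j ≤ 2 * t j / 2 ^ lev := by
  rw [S.Lb_eq]; exact Nat.div_le_div_right (Nat.mul_le_mul_left 2 (h j))

variable {S}

namespace SatData

variable (F : S.SatData)

/-! ### Shape consequences -/

/-- **`0 < Uₖₖ`** on a lower-triangular saturated basis with `0 ≤ U`: `det U·det C = Nⁿ ≠ 0` and `det U = ∏ Uₖₖ`. [folklore] -/
theorem diag_pos (htri : ∀ k j : Fin S.n, k < j → F.U k j = 0) (hbox : ∀ k j : Fin S.n, 0 ≤ F.U k j ∧ F.U k j ≤ (F.N : ℤ)) :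
    ∀ k, 0 < F.U k k := by
  classical
  have hdet : F.U.det * F.C.det = (F.N : ℤ) ^ S.n := by
    have h := congrArg Matrix.det F.hUC
    rwa [det_mul, det_smul, det_one, mul_one, Fintype.card_fin] at h
  have hlow : F.U.BlockTriangular OrderDual.toDual := fun i j hij => htri i j (by simpa using hij)
  have hprod : F.U.det = ∏ k, F.U k k := det_of_lowerTriangular F.U hlow
  have hne : ∀ k, F.U k k ≠ 0 := by
    intro k hk
    have h0 : F.U.det = 0 := by rw [hprod]; exact Finset.prod_eq_zero (Finset.mem_univ k) hk
    rw [h0, zero_mul] at hdet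
    have hN : (F.N : ℤ) ^ S.n ≠ 0 := pow_ne_zero _ (by exact_mod_cast F.hN.ne')
    exact hN hdet.symm
  intro k
  exact lt_of_le_of_ne (hbox k k).1 (fun h => hne k h.symm)

/-- **The shape of `C`**: lower-triangular, `Uₖₖ·Cₖₖ = N`, `0 < Cₖₖ`. [cite: Cassels1997, Ch. I §2.2; shape only] -/
theorem shape (htri : ∀ k j : Fin S.n, k < j → F.U k j = 0) (hbox : ∀ k j : Fin S.n, 0 ≤ F.U k j ∧ F.U k j ≤ (F.N : ℤ)) :
    (∀ j k : Fin S.n, j < k → F.C j k = 0) ∧ (∀ k, F.U k k * F.C k k = F.N) ∧ (∀ k, 0 < F.C k k) :=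
  SatBasisReduced.lower_of_mul_eq_smul_one F.hN F.hUC htri (F.diag_pos htri hbox)

/-- `Cₖₖ ≤ N` (from `Uₖₖ ≥ 1`, `Uₖₖ·Cₖₖ = N`). [folklore] -/
theorem C_diag_le (htri : ∀ k j : Fin S.n, k < j → F.U k j = 0) (hbox : ∀ k j : Fin S.n, 0 ≤ F.U k j ∧ F.U k j ≤ (F.N : ℤ))
    (k : Fin S.n) : F.C k k ≤ F.N := by
  obtain ⟨-, hdiag, hCpos⟩ := F.shape htri hbox
  have hU := F.diag_pos htri hbox k
  have h := hdiag k
  nlinarith [hCpos k]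

/-- column sums `Σᵢ |Uᵢⱼ| ≤ n·N` from the box `0 ≤ U ≤ N`. [folklore] -/
theorem colsum_le (hbox : ∀ k j : Fin S.n, 0 ≤ F.U k j ∧ F.U k j ≤ (F.N : ℤ)) (j : Fin S.n) :
    ∑ i, |F.U i j| ≤ (S.n : ℤ) * F.N := by
  calc ∑ i, |F.U i j| ≤ ∑ _i : Fin S.n, (F.N : ℤ) := Finset.sum_le_sum fun i _ => by
          rw [abs_of_nonneg (hbox i j).1]; exact (hbox i j).2
    _ = (S.n : ℤ) * F.N := by simp

/-- `(colU j : ℝ)/N ≤ n`. [folklore] -/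
theorem colU_div_le (hbox : ∀ k j : Fin S.n, 0 ≤ F.U k j ∧ F.U k j ≤ (F.N : ℤ)) (j : Fin S.n) :
    (F.colU j : ℝ) / F.N ≤ S.n := by
  rw [div_le_iff₀ F.N_pos']
  have h := F.colsum_le hbox j
  have h' : ((F.colU j : ℕ) : ℤ) ≤ (S.n : ℤ) * F.N := by
    unfold colU; push_cast; simpa [Int.natCast_natAbs] using h
  exact_mod_cast h'

/-! ### `|log θₖ|` -/

/-- **`|log θₖ| ≤ Σ_{j ≤ k} Aⱼ`** on a lower-triangular saturated basis (`θₖ^N = ∏_{j≤k} α°ⱼ^{Uₖⱼ}`, `0 ≤ Uₖⱼ ≤ N`, `|log α°ⱼ| ≤ Aⱼ`).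
[cite: Nesterenko2003, §3.4 (the basis of 𝔑); shape only] -/
theorem abs_lg_le (htri : ∀ k j : Fin S.n, k < j → F.U k j = 0) (hbox : ∀ k j : Fin S.n, 0 ≤ F.U k j ∧ F.U k j ≤ (F.N : ℤ))
    {A : Fin S.n → ℝ} (hAo : ∀ j, |Real.log (F.αo j : ℝ)| ≤ A j) (k : Fin S.n) :
    |S.lg k| ≤ ∑ j ∈ Iic k, A j := by
  classical
  have hA0 : ∀ j, 0 ≤ A j := fun j => (abs_nonneg _).trans (hAo j)
  have hN : (0 : ℝ) < F.N := F.N_pos'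
  -- `N·log θₖ = Σⱼ Uₖⱼ·log α°ⱼ`
  have hlog : (F.N : ℝ) * S.lg k = ∑ j, (F.U k j : ℝ) * Real.log (F.αo j : ℝ) := by
    have h1 : ((S.α k : ℝ)) ^ F.N = ∏ j, (F.αo j : ℝ) ^ F.U k j := by
      have := F.hU k
      exact_mod_cast this
    have h2 := congrArg Real.log h1
    rw [Real.log_pow, Real.log_prod (fun j _ => (zpow_ne_zero _ (F.αo_pos' j).ne'))] at h2
    simp_rw [Real.log_zpow] at h2
    exact h2
  have hsum : |∑ j, (F.U k j : ℝ) * Real.log (F.αo j : ℝ)| ≤ ∑ j ∈ Iic k, (F.N : ℝ) * A j := by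
    refine (abs_sum_le_sum_abs _ _).trans ?_
    have hvan : ∀ j ∈ (Finset.univ : Finset (Fin S.n)), j ∉ Iic k → |(F.U k j : ℝ) * Real.log (F.αo j : ℝ)| = 0 := by
      intro j _ hj
      rw [Finset.mem_Iic, not_le] at hj
      rw [htri k j hj]; simp
    rw [← Finset.sum_subset (Finset.subset_univ (Iic k)) hvan]
    refine Finset.sum_le_sum fun j _ => ?_
    rw [abs_mul]
    have h1 : |(F.U k j : ℝ)| ≤ F.N := by
      rw [abs_of_nonneg (by exact_mod_cast (hbox k j).1)]; exact_mod_cast (hbox k j).2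
    exact mul_le_mul h1 (hAo j) (abs_nonneg _) hN.le
  rw [← hlog, abs_mul, abs_of_pos hN, ← Finset.mul_sum] at hsum
  exact le_of_mul_le_mul_left hsum hN

/-! ### The θ-radius `sθR` -/

/-- **`sθR k ≤ (n−1)!·Σ_{j>k}(2Bv j+1) + (2Bv k+1) + 2`** (`C` lower-triangular, `|Cⱼₖ| ≤ (n−1)!N`, `Cₖₖ ≤ N`).
[cite: Nesterenko2003, §3.5 (3.25); shape only] -/
theorem sθR_le (htri : ∀ k j : Fin S.n, k < j → F.U k j = 0) (hbox : ∀ k j : Fin S.n, 0 ≤ F.U k j ∧ F.U k j ≤ (F.N : ℤ))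
    (hCb : ∀ j k : Fin S.n, |F.C j k| ≤ ((S.n - 1)! : ℤ) * F.N) (P : ArchG3Rec S.n) (k : Fin S.n) :
    S.sθR F P k ≤ (S.n - 1)! * ∑ j ∈ Ioi k, (2 * P.Bv j + 1) + (2 * P.Bv k + 1) + 2 := by
  classical
  obtain ⟨hCtri, -, hCpos⟩ := F.shape htri hbox
  have hCkk := F.C_diag_le htri hbox k
  unfold sθR
  simp only [S.LνR_zero]
  refine Nat.add_le_add_right ?_ 2
  refine Nat.div_le_of_le_mul ?_
  -- termwise: j < k ↦ 0, j = k ↦ (2Bv k+1)·N, j > k ↦ (2Bv j+1)·(n−1)!·N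
  have hterm : ∀ j, (2 * P.Bv j + 1) * (F.C j k).natAbs ≤
      (if k < j then (S.n - 1)! * (2 * P.Bv j + 1) * F.N else 0) + (if j = k then (2 * P.Bv k + 1) * F.N else 0) := by
    intro j
    rcases lt_trichotomy j k with hjk | hjk | hjk
    · rw [hCtri j k hjk]; simp
    · subst hjk
      rw [if_neg (lt_irrefl _), if_pos rfl, zero_add]
      refine Nat.mul_le_mul_left _ ?_
      have : ((F.C j j).natAbs : ℤ) ≤ F.N := by rw [Int.natAbs_of_nonneg (hCpos j).le]; exact hCkk
      exact_mod_cast this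
    · rw [if_pos hjk, if_neg (ne_of_gt hjk), add_zero]
      have h1 : ((F.C j k).natAbs : ℤ) ≤ ((S.n - 1)! : ℤ) * F.N := by rw [Int.natCast_natAbs]; exact hCb j k
      have h2 : (F.C j k).natAbs ≤ (S.n - 1)! * F.N := by exact_mod_cast h1
      calc (2 * P.Bv j + 1) * (F.C j k).natAbs ≤ (2 * P.Bv j + 1) * ((S.n - 1)! * F.N) := Nat.mul_le_mul_left _ h2
        _ = (S.n - 1)! * (2 * P.Bv j + 1) * F.N := by ring
  calc ∑ j, (2 * P.Bv j + 1) * (F.C j k).natAbs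
      ≤ ∑ j, ((if k < j then (S.n - 1)! * (2 * P.Bv j + 1) * F.N else 0) + (if j = k then (2 * P.Bv k + 1) * F.N else 0)) :=
        Finset.sum_le_sum fun j _ => hterm j
    _ = F.N * ((S.n - 1)! * ∑ j ∈ Ioi k, (2 * P.Bv j + 1) + (2 * P.Bv k + 1)) := by
        rw [Finset.sum_add_distrib, Finset.sum_ite, Finset.sum_ite, Finset.sum_const_zero, Finset.sum_const_zero, add_zero, add_zero,
          Finset.filter_lt_eq_Ioi, Finset.filter_eq']
        simp only [Finset.mem_univ, if_true, Finset.sum_singleton]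
        rw [mul_add, Finset.mul_sum, Finset.mul_sum]
        congr 1
        · exact Finset.sum_congr rfl fun j _ => by ring
        · ring

/-- **`sθR j₀ ≤ (2Bv j₀+1)·C_{j₀j₀}/N + 2`** when `j₀` is the LAST index (only `j = j₀` contributes). [cite: Nesterenko2003, §3.5 (3.25); shape only] -/
theorem sθR_last_le (htri : ∀ k j : Fin S.n, k < j → F.U k j = 0) (hbox : ∀ k j : Fin S.n, 0 ≤ F.U k j ∧ F.U k j ≤ (F.N : ℤ))
    (hlast : ∀ j, j ≤ S.j₀) (P : ArchG3Rec S.n) :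
    (S.sθR F P S.j₀ : ℝ) ≤ (2 * P.Bv S.j₀ + 1 : ℝ) * (F.C S.j₀ S.j₀) / F.N + 2 := by
  classical
  obtain ⟨hCtri, -, hCpos⟩ := F.shape htri hbox
  have hsum : ∑ j, S.LνR P 0 j * (F.C j S.j₀).natAbs = (2 * P.Bv S.j₀ + 1) * (F.C S.j₀ S.j₀).natAbs := by
    rw [Finset.sum_eq_single S.j₀ (fun j _ hj => ?_) (by simp)]
    · rw [S.LνR_zero]
    · rw [hCtri j S.j₀ (lt_of_le_of_ne (hlast j) hj)]; simp
  unfold sθR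
  rw [hsum]
  have hN : (0 : ℝ) < F.N := F.N_pos'
  have hdiv : (((2 * P.Bv S.j₀ + 1) * (F.C S.j₀ S.j₀).natAbs / F.N : ℕ) : ℝ) ≤ (2 * P.Bv S.j₀ + 1 : ℝ) * (F.C S.j₀ S.j₀) / F.N := by
    rw [le_div_iff₀ hN]
    have h1 := Nat.div_mul_le_self ((2 * P.Bv S.j₀ + 1) * (F.C S.j₀ S.j₀).natAbs) F.N
    have h2 : (((2 * P.Bv S.j₀ + 1) * (F.C S.j₀ S.j₀).natAbs / F.N * F.N : ℕ) : ℝ) ≤ (((2 * P.Bv S.j₀ + 1) * (F.C S.j₀ S.j₀).natAbs : ℕ) : ℝ) := by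
      exact_mod_cast h1
    have h3 : (((F.C S.j₀ S.j₀).natAbs : ℕ) : ℝ) = (F.C S.j₀ S.j₀ : ℝ) := by
      rw [Nat.cast_natAbs, Int.cast_abs, abs_of_pos (by exact_mod_cast hCpos S.j₀)]
    push_cast at h2 ⊢
    rw [h3] at h2
    exact h2
  push_cast
  linarith

/-! ### The transported coefficients `b̃ = b ᵥ* C` -/

/-- `b̃ₖ = Σ_{j ≥ k} bⱼ·Cⱼₖ` (`C` lower-triangular). [folklore] -/
theorem b_eq_sum_Ici (htri : ∀ k j : Fin S.n, k < j → F.U k j = 0) (hbox : ∀ k j : Fin S.n, 0 ≤ F.U k j ∧ F.U k j ≤ (F.N : ℤ))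
    (k : Fin S.n) : S.b k = ∑ j ∈ Ici k, F.bo j * F.C j k := by
  classical
  obtain ⟨hCtri, -, -⟩ := F.shape htri hbox
  have h : S.b k = ∑ j, F.bo j * F.C j k := by
    rw [F.hb]; simp [Matrix.vecMul, dotProduct]
  rw [h, ← Finset.sum_subset (Finset.subset_univ (Ici k))]
  intro j _ hj
  rw [Finset.mem_Ici, not_le] at hj
  rw [hCtri j k hj, mul_zero]

/-- `b̃_{j₀} = b_{j₀}·C_{j₀j₀}` when `j₀` is the last index. [folklore] -/
theorem b_last_eq (htri : ∀ k j : Fin S.n, k < j → F.U k j = 0) (hbox : ∀ k j : Fin S.n, 0 ≤ F.U k j ∧ F.U k j ≤ (F.N : ℤ))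
    (hlast : ∀ j, j ≤ S.j₀) : S.b S.j₀ = F.bo S.j₀ * F.C S.j₀ S.j₀ := by
  classical
  rw [F.b_eq_sum_Ici htri hbox S.j₀]
  have hI : Ici S.j₀ = {S.j₀} := by
    ext j; simp only [Finset.mem_Ici, Finset.mem_singleton]
    exact ⟨fun h => le_antisymm (hlast j) h, fun h => h ▸ le_rfl⟩
  rw [hI, Finset.sum_singleton]

/-- **`|b̃ₖ| ≤ (n−1)!·N·B·A_{j₀}·Σ_{j>k} 1/Aⱼ + N·B·A_{j₀}/Aₖ`** from `|bⱼ|·Aⱼ ≤ B·A_{j₀}`, `|Cⱼₖ| ≤ (n−1)!N` (`j > k`), `Cₖₖ ≤ N`. [folklore] -/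
theorem abs_b_le (htri : ∀ k j : Fin S.n, k < j → F.U k j = 0) (hbox : ∀ k j : Fin S.n, 0 ≤ F.U k j ∧ F.U k j ≤ (F.N : ℤ))
    (hCb : ∀ j k : Fin S.n, |F.C j k| ≤ ((S.n - 1)! : ℤ) * F.N) {A : Fin S.n → ℝ} (hA0 : ∀ j, 0 < A j) {B : ℝ}
    (hbB : ∀ j, |(F.bo j : ℝ)| * A j ≤ B * A S.j₀) (k : Fin S.n) :
    |(S.b k : ℝ)| ≤ ((S.n - 1)! : ℝ) * F.N * B * A S.j₀ * ∑ j ∈ Ioi k, 1 / A j + F.N * B * A S.j₀ / A k := by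
  classical
  obtain ⟨-, -, hCpos⟩ := F.shape htri hbox
  have hCkk := F.C_diag_le htri hbox k
  have hbo : ∀ j, |(F.bo j : ℝ)| ≤ B * A S.j₀ / A j := fun j => by rw [le_div_iff₀ (hA0 j)]; exact hbB j
  rw [F.b_eq_sum_Ici htri hbox k, ← Finset.Ioi_insert, Finset.sum_insert (by simp)]
  push_cast
  refine (abs_add_le _ _).trans ?_
  rw [add_comm]
  refine add_le_add ?_ ?_
  · refine (abs_sum_le_sum_abs _ _).trans ?_
    rw [Finset.mul_sum]
    refine Finset.sum_le_sum fun j hj => ?_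
    rw [Finset.mem_Ioi] at hj
    rw [abs_mul]
    have hC : |(F.C j k : ℝ)| ≤ ((S.n - 1)! : ℝ) * F.N := by exact_mod_cast hCb j k
    calc |(F.bo j : ℝ)| * |(F.C j k : ℝ)| ≤ (B * A S.j₀ / A j) * (((S.n - 1)! : ℝ) * F.N) :=
          mul_le_mul (hbo j) hC (abs_nonneg _) (by have := hbo j; exact (abs_nonneg _).trans this)
      _ = ((S.n - 1)! : ℝ) * F.N * B * A S.j₀ * (1 / A j) := by ring
  · rw [abs_mul]
    have hC : |(F.C k k : ℝ)| ≤ F.N := by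
      rw [abs_of_pos (by exact_mod_cast hCpos k)]; exact_mod_cast hCkk
    calc |(F.bo k : ℝ)| * |(F.C k k : ℝ)| ≤ (B * A S.j₀ / A k) * F.N :=
          mul_le_mul (hbo k) hC (abs_nonneg _) ((abs_nonneg _).trans (hbo k))
      _ = F.N * B * A S.j₀ / A k := by ring

end SatData

end ArchG3Setup

end Summit.ABC.StewartYu

end
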